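import Summits.QuantumFields.YangMills.Theorems.BalabanUVNodesN15TwoGridReadout
import Literature.MathematicalPhysics.QuantumFieldTheory.Balaban1983to89.T4EtaRateSiteOfRatePair
import HarnessLib

/-!
# Route «BalabanUVNodes» (K4 «SpineRates»), node N15 = NE2 — THE GENUINE `U ≡ 1` SITE KERNEL `(Q′G′²Q′*)⁻¹` OF [B4-I]∕[B5]: ITS TWO-GRID η-RATE (THE NE2⁰-SITE
# LETTER) HYPOTHESIS-FREE ON THE TORUS FAMILY OF RECORD, AND THE NODE-VOCABULARY READOUT `NE2ZeroSite` ∕ `NE2PlusSite` BY NAME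

Cell `pub-ymgap`, seat `pub-ymgap-dag-n15-c` (generation g7; R134 ACCELERATION SEAT, strategy s1; HUMAN RULING D-0062; chair R424 venue; `bears_on: R4∕N15`).  Filed
`--kind proof --supports stmt-QuantumFields-20296 --as helper` (K3⁵ `SpineGivenEndpointR13SepCoP`; count-neutral).  Imports BY NAME dag-n15-a's part 55
`…N15TwoGridReadout` (`TGIndex`, `tgInstance` — the realised paired-instance family of the torus family of record; through it part 49 `abs_gram_sub_le` ∕ `abs_kerRe_sub_le`
and part 52 `KRe_pairRate_member`), the (1.45)∕(1.126) engine of seats b04∕b05 (`B5QGGQ145Bounds.kerRe ∕ qggqRe`, `B5QGGQ145Factor.KRe_decay`, `B5DPD126Uniform.kerRe_decay`)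
and `T4EtaRateSiteOfRatePair` (`NE2ZeroSite`, `ne2ZeroSite_of_ne2PlusSite`); nothing in the tree is modified.

WHY (this seat's g6 erratum certificate E1 `…N15VectorPieceSiteVacuity.not_siteDatumW`, p522572).  The PIECE's own site form `Q(G⊗1)²Q*` is singular; the honest `U ≡ 1` site form of
the seat's relative faces (R2s∕R3s `SiteRelDatum`: an ABSTRACT form `Ks` with a decaying inverse, `KsWs = 1` and an η-defect letter) is Bałaban's `Q′G′²Q′*` with the FULL positive
propagator `G′ = (Δ′ + aQ′*Q′)⁻¹` ([B4-I] p.25: «⟨ω, Q′G′²Q′*ω⟩ = ‖G′Q′*ω‖²», invertible; (1.45) p.26), whose inverse `(Q′G′²Q′*)⁻¹` is EXACTLY the kernel [B9] Theorem 3.2 (3.48)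
p.398 bounds at a general background.  Its two-grid η-RATE — the `A = 0` content of the node's second conjunct `NE2PlusSite` — is NOT PRINTED ((3.48) is a majorant; King's Lemma 4.5
(4.38) p.674 is the unit-lattice `C^{(k)}`), but every ingredient is in the tree: dag-n15-a part 49 DERIVED it (`abs_kerRe_sub_le`: resolvent identity
`(Q′G′²Q′*)⁻¹′ − (Q′G′²Q′*)⁻¹ = (Q′G′²Q′*)⁻¹′·(N − N′)·(Q′G′²Q′*)⁻¹` + triple lattice convolution) MODULO the paired rate `ρ₀` of b04's kernel `K_T = G′Q′*`, and part 52 PROVED `ρ₀`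
(`KRe_pairRate_member`: King's Prop. 3.8 (3.71) line 1 at `m² = 0` on the generic torus `M_μ = 2L^{m_T}` at King's couplings `a_k = aK a L k`).  The rate of the KERNEL itself was used
only inside part 49's entry-0 theorem and never exposed; no `…TwoGrid*` file carries a site-layer face.

WHAT THIS FILE IS (ns `Summit.QuantumFields.YangMills.BalabanUVNodes.N15.GenuineSite`).
* §1 `decay_mono_tdist`, `decays_tdist` — the two tree decays (`KRe_decay`, `kerRe_decay`, uniform on a coupling window `[a₋, a₊]`) converted to King's unit-torus distance `tdist`
  (`toZ_cIdx`, `tdist_eq_torusSupNorm`) at one common rate.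
* §2 ★ `gram_rate_family`: for odd `L ≥ 3`, `a > 0`, `0 < γ < 1` there are `δ, C > 0` with, for every torus exponent `m_T`, coarse scale `k ≥ 1`, refinement `m`, every unit torus with
  `M_μ = 2L^{m_T}` and all sites `k₁, k₂`: `|Q′G′²Q′*_{L^m·L^k, a_{k+m}} − Q′G′²Q′*_{L^k, a_k}|(k₁,k₂) ≤ C·(L^k)^{−γ∕2}·e^{−δ·tdist(k₁,k₂)}` — the η-defect letter of the genuine site
  FORM; ★★ **`kerRe_rate_family`**: the same for `(Q′G′²Q′*)⁻¹` — THE NE2⁰-SITE LETTER OF THE GENUINE `U ≡ 1` SITE KERNEL, HYPOTHESIS-FREE; `kerRe_decay_family`: the (3.48)-type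
  majorant `|(Q′G′²Q′*)⁻¹_{n, a_j}(k₁,k₂)| ≤ C·e^{−δ·tdist}` on every unit torus, every grid `n`, at every King coupling `a_j` (`j ≥ 1`).
* §3 the NODE-VOCABULARY READOUT on dag-n15-a's realised paired-instance family `tgInstance d hL` (sites = the unit torus, King's `tdistT`, identity pairing of sites across the runs `k`,
  `k + m`, one-point background carrier `pt9Bg`): `etaRateIneqSite_opGeo_unit` (generic: at unit sites the `(L^jη)^{−p}(L^{j′}η)^{−d}` prefactors are `1` and the rate factor is
  `(L^k)^{−γ}`), def `genuineSiteStep d hL a i` (`(U, y, y′) ↦ (Q′G′²Q′*)⁻¹′(y,y′) − (Q′G′²Q′*)⁻¹(y,y′)`), `genuineSiteStep_ker`, `etaRateIneqSite_genuineSite_family`,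
  ★★ **`ne2PlusSite_genuineSite`** (`T4EtaRate.NE2PlusSite d′ p c₃₅ (tgInstance d hL) (genuineSiteStep d hL a)` — the node's SECOND CONJUNCT BY NAME for the genuine kernel; at the
  one-point carrier the regularity block (3.35) is VOID: the «+» is inert, the content is NE2⁰'s — said), ★★ **`ne2ZeroSite_genuineSite`** (`NE2ZeroSite d′ p …`, every `d′, p`:
  rate exponent `¼` (`γ = ½`), constants uniform in `(m_T, k, m)`).

HONEST FRAMING ∕ LIMITS.  [B5]'s SCALAR (one-component) block-averaging `Q′` and Laplacian `Δ′` at `U ≡ 1` with King's RUNNING couplings `a_k = a(1 − L⁻²)∕(1 − L^{−2k})` on the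
finite unit tori `M_μ = 2L^{m_T}`, odd `L ≥ 3`, `d + 1 ≥ 1` dimensions — a MODEL-LEVEL letter (the `A = 0` content inside NE2⁺-site's TYPE, exactly as `T4EtaRateSiteTorus`
§HONEST SCOPE (ii) says for its torus families); for the VECTOR theory in a diagonal gauge the same kernel ⊗ 1 serves (the bridge into this seat's `SiteRelDatum` is the successor
file).  Constants crude and ours.  NE2⁺ (background-dependent) NOT PRINTED, NOT proved, not claimed; count-neutral (typed 28∕28 · discharged 5∕27 of record unchanged); N15 NOT
discharged; one finite T⁴ at fixed ε — NOT ℝ⁴, NOT infinite volume, NOT OS, NOT a mass gap, NOT Clay.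
-/

noncomputable section

open scoped BigOperators Matrix
open Finset

namespace Summit.QuantumFields.YangMills.BalabanUVNodes.N15.GenuineSite

open Literature.MathematicalPhysics.QuantumFieldTheory.Balaban1983to89
open Literature.MathematicalPhysics.QuantumFieldTheory.Balaban1983to89.T4EtaRate (PairedInstance EtaRateIneqSite NE2PlusSite rateFactor)
open Literature.MathematicalPhysics.QuantumFieldTheory.Balaban1983to89.T4EtaRateSiteOfRatePair (NE2ZeroSite ne2ZeroSite_of_ne2PlusSite)
open Literature.MathematicalPhysics.QuantumFieldTheory.Balaban1983to89.T4EtaRateDefect (rateWeight)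
open Literature.MathematicalPhysics.QuantumFieldTheory.Balaban1983to89.T4EtaRateDefectSite (pt9Bg)
open Literature.MathematicalPhysics.QuantumFieldTheory.Balaban1983to89.B5Prop11Plancherel (Tor fine)
open Literature.MathematicalPhysics.QuantumFieldTheory.Balaban1983to89.B4Sect5Torus (tdist tdist_nonneg)
open Literature.MathematicalPhysics.QuantumFieldTheory.Balaban1983to89.B4TorusKernel (periodConst)
open Literature.MathematicalPhysics.QuantumFieldTheory.Balaban1983to89.B4TorusKernel.MultiPeriod (torusSupNorm)
open Literature.MathematicalPhysics.QuantumFieldTheory.Balaban1983to89.B5QGGQ145Bounds (Idx toZ kerRe qggqRe)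
open Literature.MathematicalPhysics.QuantumFieldTheory.Balaban1983to89.B5QGGQ145Factor (KRe KRe_decay)
open Literature.MathematicalPhysics.QuantumFieldTheory.Balaban1983to89.B5DPD126Uniform (cIdx toZ_cIdx tdist_eq_torusSupNorm kerRe_decay)
open Literature.MathematicalPhysics.QuantumFieldTheory.Balaban1983to89.B5PBridgeProjection (torIdx)
open Literature.MathematicalPhysics.QuantumFieldTheory.King1986 (aK aK_pos)
open Literature.MathematicalPhysics.QuantumFieldTheory.King1986.Torus (tdistT tdistT_nonneg aminL aminL_pos aminL_le_aK)
open Literature.MathematicalPhysics.QuantumFieldTheory.Balaban1983to89.B6UnitTorusCarrier (unitTorusGeo unitTorusGeo_len)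
open Summit.QuantumFields.YangMills.BalabanUVNodes.N15.OperatorReadout (opGeo opGeo_len rateFactor_opGeo)
open Summit.QuantumFields.YangMills.BalabanUVNodes.N15.TwoGrid (TGIndex tgInstance tgGeoC abs_gram_sub_le abs_kerRe_sub_le KRe_pairRate_member tdistT_eq_tdist_torIdx)
open Summit.QuantumFields.YangMills.BalabanUVNodes.N15.VectorPiece (kingPr)

variable {d : ℕ}

/-! ## §1 The tree's uniform decays of `K_T = G′Q′*` and `(Q′G′²Q′*)⁻¹` read in King's unit-torus distance -/

section Decays

/-- Rate∕constant monotonicity with the dictionary `tdist N X k′ = |toZ X − toZ k′|_{T,∞}`: `C·p·e^{−κ′|·|} ≤ CC·e^{−δ·tdist}` whenever `C·p ≤ CC`, `0 ≤ CC`, `δ ≤ κ′`. [folklore] -/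
theorem decay_mono_tdist {N0 : Fin (d + 1) → ℕ} (hN0 : ∀ i, 1 ≤ N0 i) {C pc κ' CC δ : ℝ} (X k' : Idx N0) (hCC : 0 ≤ CC) (hC : C * pc ≤ CC) (hκ : δ ≤ κ') :
    C * pc * Real.exp (-(κ' * torusSupNorm N0 (toZ X - toZ k'))) ≤ CC * Real.exp (-(δ * tdist N0 X k')) := by
  rw [← tdist_eq_torusSupNorm hN0]
  have ht := tdist_nonneg N0 X k'
  by_cases hCp : 0 ≤ C * pc
  · have hexp : Real.exp (-(κ' * tdist N0 X k')) ≤ Real.exp (-(δ * tdist N0 X k')) :=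
      Real.exp_le_exp.mpr (by nlinarith [mul_le_mul_of_nonneg_right hκ ht])
    exact mul_le_mul hC hexp (Real.exp_nonneg _) hCC
  · have h1 : C * pc * Real.exp (-(κ' * tdist N0 X k')) ≤ 0 :=
      mul_nonpos_of_nonpos_of_nonneg (le_of_lt (not_le.mp hCp)) (Real.exp_nonneg _)
    exact h1.trans (mul_nonneg hCC (Real.exp_nonneg _))

/-- **THE TWO TREE DECAYS IN KING's DISTANCE, ONE RATE.**  On a coupling window `[a₋, a₊]` (`a₋ > 0`) there are `δ > 0`, `C_K, C_I ≥ 0` such that for every grid `n`, every coupling `b`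
in the window and every unit torus: `|K_T(X, k′)| ≤ C_K·e^{−δ·tdist(B(X), k′)}` (b04's `G′Q′*`, (1.110)-type decay `KRe_decay`) and `|(Q′G′²Q′*)⁻¹(k₁,k₂)| ≤ C_I·e^{−δ·tdist(k₁,k₂)}`
(`kerRe_decay`, the `U ≡ 1` instance of [B9] (3.48)). [cite: Balaban1984PropagatorsI, Prop. 1.2 (1.110) p.35, (1.45) p.26; Balaban1985BackgroundPropagators, Thm 3.2 (3.48) p.398 (shape)] -/
theorem decays_tdist {aminus aplus : ℝ} (hamin : 0 < aminus) :
    ∃ δ CK CI : ℝ, 0 < δ ∧ 0 ≤ CK ∧ 0 ≤ CI ∧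
      (∀ (n : ℕ) [NeZero n] (b : ℝ), aminus ≤ b → b ≤ aplus → ∀ (M : Fin (d + 1) → ℕ), (∀ i, 1 ≤ M i) →
        ∀ (X : Idx (fun i => n * M i)) (k' : Idx M), |KRe n b M X k'| ≤ CK * Real.exp (-(δ * tdist M (cIdx n M X) k'))) ∧
      (∀ (n : ℕ) [NeZero n] (b : ℝ), aminus ≤ b → b ≤ aplus → ∀ (M : Fin (d + 1) → ℕ), (∀ i, 1 ≤ M i) →
        ∀ (k₁ k₂ : Idx M), |kerRe n b M k₁ k₂| ≤ CI * Real.exp (-(δ * tdist M k₁ k₂))) := by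
  obtain ⟨κ₁, M₁, hκ₁, hM₁, HKd⟩ := KRe_decay d aminus aplus hamin
  obtain ⟨κ₂, M₂, hκ₂, hM₂, HId⟩ := kerRe_decay d aminus aplus hamin
  have hd1 : (0 : ℝ) < (d : ℝ) + 1 := by positivity
  have hpc1 : 0 ≤ periodConst κ₁ d := (B5Kernel166Decay.periodConst_pos hκ₁ d).le
  have hpc2 : 0 ≤ periodConst κ₂ d := (B5Kernel166Decay.periodConst_pos hκ₂ d).le
  refine ⟨min (κ₁ / (d + 1)) (κ₂ / (d + 1)), M₁ * periodConst κ₁ d, M₂ * periodConst κ₂ d, lt_min (div_pos hκ₁ hd1) (div_pos hκ₂ hd1),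
    mul_nonneg hM₁ hpc1, mul_nonneg hM₂ hpc2, fun n _ b hb1 hb2 M hM1 X k' => ?_, fun n _ b hb1 hb2 M hM1 k₁ k₂ => ?_⟩
  · have h := HKd n b hb1 hb2 M hM1 X k'
    rw [← toZ_cIdx] at h
    exact h.trans (decay_mono_tdist hM1 (cIdx n M X) k' (mul_nonneg hM₁ hpc1) le_rfl (min_le_left _ _))
  · exact (HId n b hb1 hb2 M hM1 k₁ k₂).trans (decay_mono_tdist hM1 k₁ k₂ (mul_nonneg hM₂ hpc2) le_rfl (min_le_right _ _))

end Decays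

/-! ## §2 ★ The two-grid η-rates of the genuine site form `Q′G′²Q′*` and of its inverse, hypothesis-free on the torus family -/

section Family

variable {L : ℕ} [NeZero L]

/-- ★ **THE η-DEFECT LETTER OF THE GENUINE `U ≡ 1` SITE FORM `N = Q′G′²Q′*`** (Gram matrix of b04's `K_T = G′Q′*`): for odd `L ≥ 3`, `a > 0`, `0 < γ < 1` there are `δ, C > 0` such that
for every torus exponent `m_T`, coarse scale `k ≥ 1`, refinement `m`, every unit torus with `M_μ = 2L^{m_T}` and all sites,
`|N_{L^m·L^k, a_{k+m}} − N_{L^k, a_k}|(k₁,k₂) ≤ C·(L^k)^{−γ∕2}·e^{−δ·tdist(k₁,k₂)}` — dag-n15-a's `abs_gram_sub_le` fed with `KRe_pairRate_member` and the tree's decay of `K_T`.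
[cite: Balaban1984PropagatorsI, p.25 (the Gram form), Prop. 1.2 (1.110) p.35; King1986, Prop. 3.8 (3.71) p.664 (first line), (2.13) p.653 (the couplings)] -/
theorem gram_rate_family (hLodd : Odd L) (hL2 : 2 ≤ L) {a : ℝ} (ha : 0 < a) {γ : ℝ} (hγ0 : 0 < γ) (hγ1 : γ < 1) :
    ∃ δ C : ℝ, 0 < δ ∧ 0 < C ∧ ∀ (mT k m : ℕ) (_hk : 1 ≤ k) (M : Fin (d + 1) → ℕ) [∀ μ, NeZero (M μ)] (_hM : ∀ μ, M μ = 2 * L ^ mT) (k₁ k₂ : Idx M),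
      |qggqRe (L ^ m * L ^ k) (aK a L (k + m)) M k₁ k₂ - qggqRe (L ^ k) (aK a L k) M k₁ k₂|
        ≤ C * ((L ^ k : ℕ) : ℝ) ^ (-(γ / 2)) * Real.exp (-(δ * tdist M k₁ k₂)) := by
  have hamin := aminL_pos ha hL2
  obtain ⟨ρ, δR, hρ, hδR, P1⟩ := KRe_pairRate_member (d := d) hLodd hL2 ha hγ0 hγ1
  obtain ⟨δ₀, CK, CI, hδ₀, hCK, _hCI, HK, _HI⟩ := decays_tdist (d := d) (aplus := a) hamin
  obtain ⟨δ, hδ⟩ : ∃ δ : ℝ, δ = min δ₀ δR := ⟨_, rfl⟩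
  have hδpos : 0 < δ := hδ ▸ lt_min hδ₀ hδR
  have hδ1 : δ ≤ δ₀ := hδ ▸ min_le_left _ _
  have hδ2 : δ ≤ δR := hδ ▸ min_le_right _ _
  have hK2 : 0 ≤ B4Sect5Proof.latticeConst (d + 1) (δ / 2) := B4Sect5Proof.latticeConst_nonneg _ (by positivity)
  refine ⟨δ / 2, 2 * ρ * CK * B4Sect5Proof.latticeConst (d + 1) (δ / 2) + 1, by positivity, by positivity, fun mT k m hk M _ hM k₁ k₂ => ?_⟩
  have hM1 : ∀ i, 1 ≤ M i := fun i => Nat.one_le_iff_ne_zero.mpr (NeZero.ne (M i))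
  have hL : Odd L ∧ 1 < L := ⟨hLodd, by omega⟩
  have hLr : (1 : ℝ) < L := by exact_mod_cast (show 1 < L by omega)
  have hL0 : 0 < L := by omega
  haveI : NeZero (L ^ m * L ^ k) := ⟨Nat.mul_ne_zero (pow_ne_zero _ (NeZero.ne L)) (pow_ne_zero _ (NeZero.ne L))⟩
  have hak := aminL_le_aK ha hL2 hk
  have hakm := aminL_le_aK ha hL2 (show 1 ≤ k + m by omega)
  have haK : 0 < aK a L k := aK_pos ha hLr hk
  have haK' : 0 < aK a L (k + m) := aK_pos ha hLr (by omega)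
  have hn0 : (0 : ℝ) < ((L ^ k : ℕ) : ℝ) := by exact_mod_cast Nat.one_le_pow _ _ hL0
  have hrγ : 0 ≤ ((L ^ k : ℕ) : ℝ) ^ (-(γ / 2)) := Real.rpow_nonneg hn0.le _
  -- the decays at rate `δ`
  have hKn : ∀ (n : ℕ) [NeZero n] {b : ℝ}, aminL a L ≤ b → b ≤ a → ∀ (X : Idx (fun i => n * M i)) (k' : Idx M),
      |KRe n b M X k'| ≤ CK * Real.exp (-(δ * tdist M (cIdx n M X) k')) := fun n _ b hb1 hb2 X k' =>
    (HK n b hb1 hb2 M hM1 X k').trans (mul_le_mul_of_nonneg_left (Real.exp_le_exp.mpr (by nlinarith [tdist_nonneg M (cIdx n M X) k'])) hCK)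
  -- the paired rate at rate `δ`
  have hR0 : ∀ (w' : Tor (fine (L ^ m * L ^ k) M)) (k' : Idx M),
      |KRe (L ^ m * L ^ k) (aK a L (k + m)) M (torIdx (fine (L ^ m * L ^ k) M) w') k' - KRe (L ^ k) (aK a L k) M (torIdx (fine (L ^ k) M) (kingPr L k m M w')) k'|
        ≤ ρ * ((L ^ k : ℕ) : ℝ) ^ (-(γ / 2)) * Real.exp (-(δ * tdist M (cIdx (L ^ k) M (torIdx (fine (L ^ k) M) (kingPr L k m M w'))) k')) :=
    fun w' k' => (P1 mT k m hk hL M hM w' k').trans (mul_le_mul_of_nonneg_left (Real.exp_le_exp.mpr (by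
      nlinarith [tdist_nonneg M (cIdx (L ^ k) M (torIdx (fine (L ^ k) M) (kingPr L k m M w'))) k'])) (mul_nonneg hρ.le hrγ))
  have h := abs_gram_sub_le M k m haK haK' hCK hδpos (mul_nonneg hρ.le hrγ) (hKn (L ^ k) hak.1 hak.2) (hKn (L ^ m * L ^ k) hakm.1 hakm.2) hR0 k₁ k₂
  refine h.trans ?_
  have hE := Real.exp_nonneg (-(δ / 2 * tdist M k₁ k₂))
  have heq : 2 * (ρ * ((L ^ k : ℕ) : ℝ) ^ (-(γ / 2))) * CK * B4Sect5Proof.latticeConst (d + 1) (δ / 2)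
      = (2 * ρ * CK * B4Sect5Proof.latticeConst (d + 1) (δ / 2)) * ((L ^ k : ℕ) : ℝ) ^ (-(γ / 2)) := by ring
  rw [heq]
  refine mul_le_mul_of_nonneg_right (mul_le_mul_of_nonneg_right (by linarith) hrγ) hE

/-- ★★ **THE NE2⁰-SITE LETTER OF THE GENUINE `U ≡ 1` SITE KERNEL `(Q′G′²Q′*)⁻¹`, HYPOTHESIS-FREE.**  For odd `L ≥ 3`, `a > 0`, `0 < γ < 1` there are `δ, C > 0` such that for every
torus exponent `m_T`, coarse scale `k ≥ 1`, refinement `m`, every unit torus with `M_μ = 2L^{m_T}` and all sites `k₁, k₂`: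
`|(Q′G′²Q′*)⁻¹_{L^m·L^k, a_{k+m}} − (Q′G′²Q′*)⁻¹_{L^k, a_k}|(k₁,k₂) ≤ C·(L^k)^{−γ∕2}·e^{−δ·tdist(k₁,k₂)}` — dag-n15-a's `abs_kerRe_sub_le` (resolvent identity (1.45) + triple
convolution) fed with `KRe_pairRate_member` (King (3.71) line 1 at `m² = 0`) and the tree's two decays.  The η-rate of the kernel of [B9] Theorem 3.2 at `U ≡ 1`: NOT PRINTED; a
model-level theorem here. [cite: Balaban1984PropagatorsI, (1.45) p.26, Prop. 1.2 (1.110) p.35; Balaban1985BackgroundPropagators, Thm 3.2 (3.48) p.398 (the kernel; majorant only);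
King1986, Prop. 3.8 (3.71) p.664, Lemma 4.5 (4.38) p.674 (rate shape)] -/
theorem kerRe_rate_family (hLodd : Odd L) (hL2 : 2 ≤ L) {a : ℝ} (ha : 0 < a) {γ : ℝ} (hγ0 : 0 < γ) (hγ1 : γ < 1) :
    ∃ δ C : ℝ, 0 < δ ∧ 0 < C ∧ ∀ (mT k m : ℕ) (_hk : 1 ≤ k) (M : Fin (d + 1) → ℕ) [∀ μ, NeZero (M μ)] (_hM : ∀ μ, M μ = 2 * L ^ mT) (k₁ k₂ : Idx M),
      |kerRe (L ^ m * L ^ k) (aK a L (k + m)) M k₁ k₂ - kerRe (L ^ k) (aK a L k) M k₁ k₂|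
        ≤ C * ((L ^ k : ℕ) : ℝ) ^ (-(γ / 2)) * Real.exp (-(δ * tdist M k₁ k₂)) := by
  have hamin := aminL_pos ha hL2
  obtain ⟨ρ, δR, hρ, hδR, P1⟩ := KRe_pairRate_member (d := d) hLodd hL2 ha hγ0 hγ1
  obtain ⟨δ₀, CK, CI, hδ₀, hCK, hCI, HK, HI⟩ := decays_tdist (d := d) (aplus := a) hamin
  obtain ⟨δ, hδ⟩ : ∃ δ : ℝ, δ = min δ₀ δR := ⟨_, rfl⟩
  have hδpos : 0 < δ := hδ ▸ lt_min hδ₀ hδR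
  have hδ1 : δ ≤ δ₀ := hδ ▸ min_le_left _ _
  have hδ2 : δ ≤ δR := hδ ▸ min_le_right _ _
  have hK2 : 0 ≤ B4Sect5Proof.latticeConst (d + 1) (δ / 2) := B4Sect5Proof.latticeConst_nonneg _ (by positivity)
  have hK4 : 0 ≤ B4Sect5Proof.latticeConst (d + 1) (δ / 2 / 2) := B4Sect5Proof.latticeConst_nonneg _ (by positivity)
  have hK8 : 0 ≤ B4Sect5Proof.latticeConst (d + 1) (δ / 2 / 4) := B4Sect5Proof.latticeConst_nonneg _ (by positivity)
  obtain ⟨C3, hC3⟩ : ∃ C3 : ℝ, C3 = CI * (2 * ρ * CK * B4Sect5Proof.latticeConst (d + 1) (δ / 2)) * CI * B4Sect5Proof.latticeConst (d + 1) (δ / 2 / 2) *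
      B4Sect5Proof.latticeConst (d + 1) (δ / 2 / 4) := ⟨_, rfl⟩
  have hC30 : 0 ≤ C3 := hC3 ▸ mul_nonneg (mul_nonneg (mul_nonneg (mul_nonneg hCI (by positivity)) hCI) hK4) hK8
  refine ⟨δ / 2 / 4, C3 + 1, by positivity, by positivity, fun mT k m hk M _ hM k₁ k₂ => ?_⟩
  have hM1 : ∀ i, 1 ≤ M i := fun i => Nat.one_le_iff_ne_zero.mpr (NeZero.ne (M i))
  have hL : Odd L ∧ 1 < L := ⟨hLodd, by omega⟩
  have hLr : (1 : ℝ) < L := by exact_mod_cast (show 1 < L by omega)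
  have hL0 : 0 < L := by omega
  haveI : NeZero (L ^ m * L ^ k) := ⟨Nat.mul_ne_zero (pow_ne_zero _ (NeZero.ne L)) (pow_ne_zero _ (NeZero.ne L))⟩
  have hak := aminL_le_aK ha hL2 hk
  have hakm := aminL_le_aK ha hL2 (show 1 ≤ k + m by omega)
  have haK : 0 < aK a L k := aK_pos ha hLr hk
  have haK' : 0 < aK a L (k + m) := aK_pos ha hLr (by omega)
  have hn0 : (0 : ℝ) < ((L ^ k : ℕ) : ℝ) := by exact_mod_cast Nat.one_le_pow _ _ hL0
  have hrγ : 0 ≤ ((L ^ k : ℕ) : ℝ) ^ (-(γ / 2)) := Real.rpow_nonneg hn0.le _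
  have hKn : ∀ (n : ℕ) [NeZero n] {b : ℝ}, aminL a L ≤ b → b ≤ a → ∀ (X : Idx (fun i => n * M i)) (k' : Idx M),
      |KRe n b M X k'| ≤ CK * Real.exp (-(δ * tdist M (cIdx n M X) k')) := fun n _ b hb1 hb2 X k' =>
    (HK n b hb1 hb2 M hM1 X k').trans (mul_le_mul_of_nonneg_left (Real.exp_le_exp.mpr (by nlinarith [tdist_nonneg M (cIdx n M X) k'])) hCK)
  have hIn : ∀ (n : ℕ) [NeZero n] {b : ℝ}, aminL a L ≤ b → b ≤ a → ∀ k₁ k₂ : Idx M,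
      |kerRe n b M k₁ k₂| ≤ CI * Real.exp (-(δ * tdist M k₁ k₂)) := fun n _ b hb1 hb2 k₁ k₂ =>
    (HI n b hb1 hb2 M hM1 k₁ k₂).trans (mul_le_mul_of_nonneg_left (Real.exp_le_exp.mpr (by nlinarith [tdist_nonneg M k₁ k₂])) hCI)
  have hR0 : ∀ (w' : Tor (fine (L ^ m * L ^ k) M)) (k' : Idx M),
      |KRe (L ^ m * L ^ k) (aK a L (k + m)) M (torIdx (fine (L ^ m * L ^ k) M) w') k' - KRe (L ^ k) (aK a L k) M (torIdx (fine (L ^ k) M) (kingPr L k m M w')) k'|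
        ≤ ρ * ((L ^ k : ℕ) : ℝ) ^ (-(γ / 2)) * Real.exp (-(δ * tdist M (cIdx (L ^ k) M (torIdx (fine (L ^ k) M) (kingPr L k m M w'))) k')) :=
    fun w' k' => (P1 mT k m hk hL M hM w' k').trans (mul_le_mul_of_nonneg_left (Real.exp_le_exp.mpr (by
      nlinarith [tdist_nonneg M (cIdx (L ^ k) M (torIdx (fine (L ^ k) M) (kingPr L k m M w'))) k'])) (mul_nonneg hρ.le hrγ))
  have h := abs_kerRe_sub_le M k m haK haK' hCK hCI hδpos (mul_nonneg hρ.le hrγ) (hKn (L ^ k) hak.1 hak.2) (hKn (L ^ m * L ^ k) hakm.1 hakm.2)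
    (hIn (L ^ k) hak.1 hak.2) (hIn (L ^ m * L ^ k) hakm.1 hakm.2) hR0 k₁ k₂
  refine h.trans ?_
  have hE := Real.exp_nonneg (-(δ / 2 / 4 * tdist M k₁ k₂))
  have heq : CI * (2 * (ρ * ((L ^ k : ℕ) : ℝ) ^ (-(γ / 2))) * CK * B4Sect5Proof.latticeConst (d + 1) (δ / 2)) * CI * B4Sect5Proof.latticeConst (d + 1) (δ / 2 / 2) *
      B4Sect5Proof.latticeConst (d + 1) (δ / 2 / 4) = C3 * ((L ^ k : ℕ) : ℝ) ^ (-(γ / 2)) := by rw [hC3]; ring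
  rw [heq]
  exact mul_le_mul_of_nonneg_right (mul_le_mul_of_nonneg_right (by linarith) hrγ) hE

omit [NeZero L] in
/-- **THE (3.48)-TYPE MAJORANT OF THE GENUINE `U ≡ 1` SITE KERNEL AT KING's COUPLINGS, EVERY TORUS, EVERY GRID**: for `L ≥ 2`, `a > 0` there are `δ, C > 0` with
`|(Q′G′²Q′*)⁻¹_{n, a_j}(k₁,k₂)| ≤ C·e^{−δ·tdist(k₁,k₂)}` for every `j ≥ 1`, grid `n ≥ 1` and unit torus (all `M_μ ≥ 1`) — b05's `kerRe_decay` on the window `[a(1 − L⁻²), a]`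
that contains every `a_j`. [cite: Balaban1984PropagatorsI, (1.45) p.26; Balaban1985BackgroundPropagators, Thm 3.2 (3.48) p.398 (the `U ≡ 1` instance); King1986, (2.13) p.653] -/
theorem kerRe_decay_family (hL2 : 2 ≤ L) {a : ℝ} (ha : 0 < a) :
    ∃ δ C : ℝ, 0 < δ ∧ 0 < C ∧ ∀ (j : ℕ) (_hj : 1 ≤ j) (n : ℕ) [NeZero n] (M : Fin (d + 1) → ℕ) [∀ μ, NeZero (M μ)] (k₁ k₂ : Idx M),
      |kerRe n (aK a L j) M k₁ k₂| ≤ C * Real.exp (-(δ * tdist M k₁ k₂)) := by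
  have hamin := aminL_pos ha hL2
  obtain ⟨δ₀, CK, CI, hδ₀, _hCK, hCI, _HK, HI⟩ := decays_tdist (d := d) (aplus := a) hamin
  refine ⟨δ₀, CI + 1, hδ₀, by positivity, fun j hj n _ M _ k₁ k₂ => ?_⟩
  have hM1 : ∀ i, 1 ≤ M i := fun i => Nat.one_le_iff_ne_zero.mpr (NeZero.ne (M i))
  have haj := aminL_le_aK ha hL2 hj
  exact (HI n (aK a L j) haj.1 haj.2 M hM1 k₁ k₂).trans (mul_le_mul_of_nonneg_right (by linarith) (Real.exp_nonneg _))

end Family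

/-! ## §3 The node-vocabulary readout: `NE2ZeroSite` ∕ `NE2PlusSite` BY NAME for the genuine kernel on dag-n15-a's realised paired-instance family -/

section Readout

/-- **GENERIC UNIT-SITE READOUT of `EtaRateIneqSite`** on n15-b's realised geometry `opGeo g X blk` when every site has physical size `L^jη = 1` (`η ≠ 0`, `L > 0`): the prefactors
`(L^jη)^{−p}·(L^{j′}η)^{−d′}` are `1` and King's rate factor is the defect calculus' rate weight `(L^j)^{−γ}` (`rateFactor_opGeo`) — so a pointwise kernel bound
`|K(y,y′)| ≤ C·e^{−δd(y,y′)}·max(w_γ(y), w_γ(y′))` IS the packaged inequality, for every `d′, p`. [cite: Balaban1985BackgroundPropagators, Thm 3.2 (3.48) p.398 (shape)] -/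
theorem etaRateIneqSite_opGeo_unit {g : B6.Geometry} {X : Type} [Fintype X] {blk : X → g.Site} {B : B9.Backgrounds} (Kd : B9.SiteKernel (opGeo g X blk) B)
    (hlen : ∀ y : g.Site, g.len y = 1) (hη : g.eta ≠ 0) (hL : 0 < g.L) {C δ γ : ℝ} {U : B.Cfg}
    (h : ∀ y y' : g.Site, |Kd.ker U y y'| ≤ C * Real.exp (-(δ * g.dist y y')) * max (rateWeight g γ y) (rateWeight g γ y')) (d' : ℕ) (p : ℝ) :
    EtaRateIneqSite d' p Kd C δ γ U := by
  intro y y'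
  rw [opGeo_len, opGeo_len, hlen, hlen, Real.one_rpow, Real.one_rpow, mul_one, mul_one, rateFactor_opGeo _ _ _ hη hL, rateFactor_opGeo _ _ _ hη hL]
  exact h y y'

variable {L : ℕ} [NeZero L]

/-- **THE GENUINE `U ≡ 1` SITE-KERNEL η-DIFFERENCE on the realised paired-instance family of the torus family of record** (dag-n15-a part 55 `tgInstance`: coarse∕fine unit-torus
carriers of the runs `k`, `k + m`, identity pairing of sites, one-point backgrounds): `(U, y, y′) ↦ (Q′G′²Q′*)⁻¹_{L^m·L^k, a_{k+m}}(y,y′) − (Q′G′²Q′*)⁻¹_{L^k, a_k}(y,y′)` — the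
`U ≡ 1` instance of the η-difference of the kernel of [B9] Theorem 3.2, at King's couplings. [cite: Balaban1985BackgroundPropagators, Thm 3.2 (3.48) p.398 (the kernel);
Balaban1984PropagatorsI, (1.45) p.26; King1986, p.664 (identity pairing convention before Prop. 3.8)] -/
def genuineSiteStep (d : ℕ) (hL : Odd L ∧ 1 < L) (a : ℝ) (i : TGIndex) : B9.SiteKernel (tgInstance d hL i).gc (tgInstance d hL i).Bf :=
  show B9.SiteKernel (tgGeoC d hL i) pt9Bg from
    ⟨fun _ y y' => kerRe (L ^ i.m * L ^ i.k) (aK a L (i.k + i.m)) (TGIndex.Mn d hL i) (torIdx (TGIndex.Mn d hL i) y) (torIdx (TGIndex.Mn d hL i) y')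
        - kerRe (L ^ i.k) (aK a L i.k) (TGIndex.Mn d hL i) (torIdx (TGIndex.Mn d hL i) y) (torIdx (TGIndex.Mn d hL i) y')⟩

/-- Unfolding of `genuineSiteStep`. [folklore] -/
theorem genuineSiteStep_ker (hL : Odd L ∧ 1 < L) (a : ℝ) (i : TGIndex) (U : Unit) (y y' : Tor (TGIndex.Mn d hL i)) :
    (genuineSiteStep d hL a i).ker U y y'
      = kerRe (L ^ i.m * L ^ i.k) (aK a L (i.k + i.m)) (TGIndex.Mn d hL i) (torIdx (TGIndex.Mn d hL i) y) (torIdx (TGIndex.Mn d hL i) y')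
        - kerRe (L ^ i.k) (aK a L i.k) (TGIndex.Mn d hL i) (torIdx (TGIndex.Mn d hL i) y) (torIdx (TGIndex.Mn d hL i) y') := rfl

/-- **THE SITE INEQUALITY FOR THE GENUINE KERNEL, UNIFORMLY OVER THE FAMILY**: for odd `L ≥ 3`, `a > 0` there are `δ, C > 0` such that at EVERY index and every (one-point)
configuration `EtaRateIneqSite d′ p (genuineSiteStep d hL a i) C δ ¼ U` — `kerRe_rate_family` at `γ = ½` read through `etaRateIneqSite_opGeo_unit` (`tdistT = tdist ∘ torIdx`).
[cite: Balaban1985BackgroundPropagators, Thm 3.2 (3.48) p.398 (shape); King1986, Prop. 3.8 (3.71) p.664, Lemma 4.5 (4.38) p.674 (rate shape)] -/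
theorem etaRateIneqSite_genuineSite_family (hLodd : Odd L) (hL2 : 2 ≤ L) (hL : Odd L ∧ 1 < L) {a : ℝ} (ha : 0 < a) (d' : ℕ) (p : ℝ) :
    ∃ δ C : ℝ, 0 < δ ∧ 0 < C ∧ ∀ (i : TGIndex) (U : Unit), EtaRateIneqSite d' p (genuineSiteStep d hL a i) C δ (1 / 4) U := by
  obtain ⟨δ, C, hδ, hC, H⟩ := kerRe_rate_family (d := d) hLodd hL2 ha (γ := 1 / 2) (by norm_num) (by norm_num)
  refine ⟨δ, C, hδ, hC, fun i U => ?_⟩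
  have hL0 : L ≠ 0 := NeZero.ne L
  have hLr : (0 : ℝ) < (L : ℝ) := by exact_mod_cast Nat.pos_of_ne_zero hL0
  have hη : (unitTorusGeo L i.k (TGIndex.Mn d hL i)).eta ≠ 0 := inv_ne_zero (pow_ne_zero _ hLr.ne')
  refine etaRateIneqSite_opGeo_unit (g := unitTorusGeo L i.k (TGIndex.Mn d hL i)) (B := pt9Bg) (genuineSiteStep d hL a i)
    (unitTorusGeo_len L i.k (TGIndex.Mn d hL i) hL0) hη hLr (fun y y' => ?_) d' p
  have h := H i.mT i.k i.m i.one_le (TGIndex.Mn d hL i) (fun μ => rfl) (torIdx (TGIndex.Mn d hL i) y) (torIdx (TGIndex.Mn d hL i) y')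
  have hcast : ((L ^ i.k : ℕ) : ℝ) = (L : ℝ) ^ i.k := by push_cast; ring
  have hq : (-((1 : ℝ) / 2 / 2)) = -(1 / 4) := by norm_num
  rw [hcast, hq, ← tdistT_eq_tdist_torIdx] at h
  show |kerRe (L ^ i.m * L ^ i.k) (aK a L (i.k + i.m)) (TGIndex.Mn d hL i) (torIdx (TGIndex.Mn d hL i) y) (torIdx (TGIndex.Mn d hL i) y')
      - kerRe (L ^ i.k) (aK a L i.k) (TGIndex.Mn d hL i) (torIdx (TGIndex.Mn d hL i) y) (torIdx (TGIndex.Mn d hL i) y')|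
    ≤ C * Real.exp (-(δ * tdistT (TGIndex.Mn d hL i) y y')) * max (((L : ℝ) ^ i.k) ^ (-(1 / 4 : ℝ))) (((L : ℝ) ^ i.k) ^ (-(1 / 4 : ℝ)))
  rw [max_self]
  calc _ ≤ C * ((L : ℝ) ^ i.k) ^ (-(1 / 4 : ℝ)) * Real.exp (-(δ * tdistT (TGIndex.Mn d hL i) y y')) := h
    _ = _ := by ring

/-- ★★ **`NE2PlusSite` — THE NODE's SECOND CONJUNCT BY NAME — FOR THE GENUINE `U ≡ 1` SITE KERNEL `(Q′G′²Q′*)⁻¹` ON THE TORUS FAMILY OF RECORD**, every exponent pair `(d′, p)` and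
geometric constant `c₃₅`: constants `(M₅, δ, a₀, C, γ) = (1, δ, 1, C, ¼)` uniform in `(m_T, k, m)`; odd `L ≥ 3`, `a > 0`.  HONEST SCOPE: one-point background carrier — the regularity
block (3.35) is VOID there, the «+» is inert and the content is NE2⁰'s (`ne2ZeroSite_genuineSite`); rate, decay and uniformity genuine; [B5]'s scalar kernel at King's couplings.
[cite: Balaban1985BackgroundPropagators, Thm 3.2 (3.48) p.398 + Thm 3.14 pp.426–427 (quantifier template)] -/
theorem ne2PlusSite_genuineSite (hLodd : Odd L) (hL2 : 2 ≤ L) (hL : Odd L ∧ 1 < L) {a : ℝ} (ha : 0 < a) (d' : ℕ) (p c35 : ℝ) :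
    NE2PlusSite d' p c35 (tgInstance d hL) (genuineSiteStep d hL a) := by
  obtain ⟨δ, C, hδ, hC, H⟩ := etaRateIneqSite_genuineSite_family (d := d) hLodd hL2 hL ha d' p
  exact ⟨1, δ, 1, C, 1 / 4, one_pos, hδ, one_pos, hC, by norm_num, fun i _ _ _ _ U _ => H i U⟩

/-- ★★ **`NE2ZeroSite` FOR THE GENUINE `U ≡ 1` SITE KERNEL `(Q′G′²Q′*)⁻¹` ON THE TORUS FAMILY OF RECORD** — the NE2⁰-site letter BY NAME, hypothesis-free in the background (there is
none but `U ≡ 1`), every `(d′, p)`; odd `L ≥ 3`, `a > 0`. [cite: Balaban1985BackgroundPropagators, Thm 3.2 (3.48) p.398 (the kernel); King1986, Lemma 4.5 (4.38) p.674 (A = 0 template)] -/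
theorem ne2ZeroSite_genuineSite (hLodd : Odd L) (hL2 : 2 ≤ L) (hL : Odd L ∧ 1 < L) {a : ℝ} (ha : 0 < a) (d' : ℕ) (p : ℝ) :
    NE2ZeroSite d' p (tgInstance d hL) (genuineSiteStep d hL a) :=
  ne2ZeroSite_of_ne2PlusSite (c35 := 0) (fun _ _ _ => trivial) (ne2PlusSite_genuineSite (d := d) hLodd hL2 hL ha d' p 0)

end Readout

end Summit.QuantumFields.YangMills.BalabanUVNodes.N15.GenuineSite
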